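import Mathlib
import Literature.NumberTheory.Transcendental.TijdemanZeroEstimate
import Literature.NumberTheory.Transcendental.BakerLogarithmsAnalytic
import HarnessLib

/-!
# Tijdeman's zero estimate for exponential polynomials — proof

`Literature/NumberTheory/Transcendental/TijdemanZeroEstimateProofs.lean` — sibling proofs file of
`TijdemanZeroEstimate.lean`: **discharges the named fact `Baker1975_tijdemanLemma`** (Baker 1975,
Ch. 12 §2, Lemma 1: the number of zeros, counted with multiplicities, of
`F(z) = ∑_{k<K} ∑_{l≤L} f(k,l) z^k e^{σ_l z}` (`|σ_l| ≤ S`, `F ≢ 0`) in a closed disc of radius `R`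
is `≤ c (KL + RS)` for an absolute constant `c`; here `c = 30`).

## The argument

Baker's proof (pp. 113–114) has two halves.

* *Growth.* `M(ρ') ≤ M(ρ) e^{2ρ'S} ∑_{n<N} (ρ'/ρ)^n` (`N = KL`), which Baker derives from the
  Hermite interpolation polynomial of `w ↦ e^{zw}` at the frequencies. We obtain a bound of the
  same shape, `|F(w)| ≤ M(ρ) exp((2S + 2N/ρ)|w - z₀|)` (`expPolynomial_growth`), from the
  differential equation instead: with `η₀, …, η_{N-1}` the frequencies repeated `K` times each and
  `F₀ = F`, `F_{j+1} = F_j' - η_j F_j`, one has `F_N = 0` (the operators `D - η` commute — they are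
  polynomials in `D = d/dX` acting on the coefficient polynomials, `pseq_eq_aeval` — and `D^K`
  kills the coefficients, of degree `< K`: `pseq_coeffPoly_eq_zero`); integrating
  `F_j' - η_j F_j = F_{j+1}` along the segment `[z₀, w]` (`norm_le_of_hasDerivAt`) gives, by
  downward induction, `|F_j(w)| ≤ e^{S|w-z₀|} ∑_{n<N-j} |F_{j+n}(z₀)| |w-z₀|^n/n!`
  (`norm_fseq_le`), while Cauchy's inequality on shrinking discs gives
  `|F_i(z₀)| ≤ (2N/ρ + S)^i M(ρ)` (`norm_fseq_ball_le`); summing, `qexp_growth`.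
* *Counting* (Baker's Jensen-type argument, p. 113, verbatim): write `F = W · G` with
  `W = ∏ (z - a)` over the given zeros (with multiplicities) in the disc of radius `R` about `z₀`
  and `G` entire (`exists_eq_multiset_prod_mul`); the maximum modulus principle for `G` on the
  disc of radius `5R` gives `2^h M(R) ≤ M(5R)`, `h` the number of zeros, whence with the growth
  bound `h log 2 ≤ 10RS + 10N` (`card_mul_log_two_le`). The case `R = 0` is absorbed by working
  with the radius `R + 1/(S+1)`.

Main results: `card_zeroMultiset_expPolynomial_le` (the lemma with the explicit constant `30`)
and `Baker1975_tijdemanLemma_holds : Baker1975_tijdemanLemma`. The auxiliary definitions `qexp`,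
`pstep`, `pseq`, `coeffPoly`, `freq` (namespace `Tijdeman`) are proof devices only.

## References

* [BakerTNT1975] A. Baker, *Transcendental Number Theory*, Cambridge Univ. Press (1975), Ch. 12
  §2, Lemma 1, pp. 112–114.
* R. Tijdeman, *On the number of zeros of general exponential polynomials*, Indag. Math. 33
  (1971), 1–7 (not held; Baker's rendering is proved here with `c = 30`).
-/

noncomputable section

open scoped Classical Nat
open Complex Metric Polynomial Finset Filter Topology

namespace Literature.NumberTheory.Transcendental

namespace Tijdeman

/-! ### Exponential polynomials as `∑ Q_l(z) e^{σ_l z}` and the operators `D - a` -/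

variable {L : ℕ}

/-- `∑_l Q_l(z) e^{σ_l z}` for polynomials `Q_l ∈ ℂ[X]`. [folklore] -/
def qexp (Q : Fin L → ℂ[X]) (σ : Fin L → ℂ) : ℂ → ℂ :=
  fun z => ∑ l, (Q l).eval z * cexp (σ l * z)

/-- The effect of `D - a` on the coefficient polynomials: `Q_l ↦ Q_l' + (σ_l - a) Q_l`. [folklore] -/
def pstep (σ : Fin L → ℂ) (a : ℂ) (Q : Fin L → ℂ[X]) : Fin L → ℂ[X] :=
  fun l => derivative (Q l) + C (σ l - a) * Q l

/-- `(D - a)(∑ Q_l e^{σ_l z}) = ∑ (Q_l' + (σ_l - a)Q_l) e^{σ_l z}`, as a `HasDerivAt` statement.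
[folklore] -/
theorem hasDerivAt_qexp (Q : Fin L → ℂ[X]) (σ : Fin L → ℂ) (a z : ℂ) :
    HasDerivAt (qexp Q σ) (qexp (pstep σ a Q) σ z + a * qexp Q σ z) z := by
  have h : ∀ l ∈ (univ : Finset (Fin L)),
      HasDerivAt (fun z => (Q l).eval z * cexp (σ l * z))
        ((derivative (Q l)).eval z * cexp (σ l * z) + (Q l).eval z * (cexp (σ l * z) * σ l)) z := by
    intro l _
    have h1 : HasDerivAt (fun z => (Q l).eval z) ((derivative (Q l)).eval z) z := Polynomial.hasDerivAt _ _
    have h2 : HasDerivAt (fun z => cexp (σ l * z)) (cexp (σ l * z) * σ l) z := by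
      have : HasDerivAt (fun z => σ l * z) (σ l) z := by simpa using (hasDerivAt_id z).const_mul (σ l)
      simpa using this.cexp
    exact h1.mul h2
  have hs : HasDerivAt (qexp Q σ) (∑ l ∈ (univ : Finset (Fin L)),
      ((derivative (Q l)).eval z * cexp (σ l * z) + (Q l).eval z * (cexp (σ l * z) * σ l))) z :=
    HasDerivAt.fun_sum h
  have heq : (∑ l ∈ (univ : Finset (Fin L)),
      ((derivative (Q l)).eval z * cexp (σ l * z) + (Q l).eval z * (cexp (σ l * z) * σ l))) =
      qexp (pstep σ a Q) σ z + a * qexp Q σ z := by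
    simp only [qexp, pstep, eval_add, eval_mul, eval_C, Finset.mul_sum, ← Finset.sum_add_distrib]
    refine Finset.sum_congr rfl fun l _ => ?_
    ring
  rwa [heq] at hs

/-- `qexp` is entire. [folklore] -/
theorem differentiable_qexp (Q : Fin L → ℂ[X]) (σ : Fin L → ℂ) : Differentiable ℂ (qexp Q σ) :=
  fun z => (hasDerivAt_qexp Q σ 0 z).differentiableAt

/-- `deriv (qexp Q σ) z - a qexp Q σ z = qexp (pstep σ a Q) σ z`. [folklore] -/
theorem deriv_qexp_sub (Q : Fin L → ℂ[X]) (σ : Fin L → ℂ) (a z : ℂ) :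
    deriv (qexp Q σ) z - a * qexp Q σ z = qexp (pstep σ a Q) σ z := by
  rw [(hasDerivAt_qexp Q σ a z).deriv]
  ring

/-- Iterating `pstep` along a sequence of shifts `η₀, η₁, …`. [folklore] -/
def pseq (σ : Fin L → ℂ) (η : ℕ → ℂ) (Q : Fin L → ℂ[X]) : ℕ → Fin L → ℂ[X]
  | 0 => Q
  | j + 1 => pstep σ (η j) (pseq σ η Q j)

/-- `pseq` at `0`. [folklore] -/
@[simp] theorem pseq_zero (σ : Fin L → ℂ) (η : ℕ → ℂ) (Q : Fin L → ℂ[X]) : pseq σ η Q 0 = Q := rfl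

/-- `pseq` at a successor. [folklore] -/
theorem pseq_succ (σ : Fin L → ℂ) (η : ℕ → ℂ) (Q : Fin L → ℂ[X]) (j : ℕ) :
    pseq σ η Q (j + 1) = pstep σ (η j) (pseq σ η Q j) := rfl

/-- The operator form: `pseq … j l = (∏_{i<j} (D + (σ_l - η_i))) Q_l` with `D = d/dX` acting on
`ℂ[X]`. [folklore] -/
theorem pseq_eq_aeval (σ : Fin L → ℂ) (η : ℕ → ℂ) (Q : Fin L → ℂ[X]) (j : ℕ) (l : Fin L) :
    pseq σ η Q j l =
      Polynomial.aeval (R := ℂ) (Polynomial.derivative : Module.End ℂ ℂ[X])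
        (∏ i ∈ range j, (X + C (σ l - η i))) (Q l) := by
  induction j with
  | zero => simp
  | succ j ih =>
    rw [pseq_succ, pstep, Finset.prod_range_succ_comm, map_mul, Module.End.mul_apply, ← ih]
    simp only [map_add, map_sub, Polynomial.aeval_X, Polynomial.aeval_C, LinearMap.add_apply,
      LinearMap.sub_apply, Module.algebraMap_end_apply, Polynomial.smul_eq_C_mul]
    ring

/-- If among `η₀, …, η_{N-1}` the value `σ_l` occurs with multiplicity at least `K > natDegree Q_l`
(here: the product `∏_{i<N} (X + (σ_l - η_i))` is divisible by `X^K` and `Q_l^{(K)} = 0`), then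
the `N`-th iterate vanishes. [folklore] -/
theorem pseq_eq_zero_of_dvd (σ : Fin L → ℂ) (η : ℕ → ℂ) (Q : Fin L → ℂ[X]) {N K : ℕ} (l : Fin L)
    (hdvd : X ^ K ∣ ∏ i ∈ range N, (X + C (σ l - η i)))
    (hQ : derivative^[K] (Q l) = 0) : pseq σ η Q N l = 0 := by
  obtain ⟨P, hP⟩ := hdvd
  rw [pseq_eq_aeval, hP, mul_comm, map_mul, Module.End.mul_apply, map_pow, Polynomial.aeval_X,
    Module.End.pow_apply, hQ, map_zero]


/-! ### Baker's `F` in this form; the frequencies repeated `K` times -/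

variable {K : ℕ}

/-- The coefficient polynomials `P_l = ∑_k f(k,l) X^k` of `expPolynomial f σ`. [folklore] -/
def coeffPoly (f : Fin K → Fin L → ℂ) : Fin L → ℂ[X] :=
  fun l => ∑ k, C (f k l) * X ^ (k : ℕ)

/-- `expPolynomial f σ = ∑_l P_l(z) e^{σ_l z}`. [folklore] -/
theorem expPolynomial_eq_qexp (f : Fin K → Fin L → ℂ) (σ : Fin L → ℂ) :
    expPolynomial f σ = qexp (coeffPoly f) σ := by
  funext z
  simp only [expPolynomial, qexp, coeffPoly, eval_finsetSum, eval_mul, eval_C, eval_pow, eval_X,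
    Finset.sum_mul]
  rw [Finset.sum_comm]

/-- `P_l^{(K)} = 0` (`deg P_l < K`). [folklore] -/
theorem iterate_derivative_coeffPoly (f : Fin K → Fin L → ℂ) (l : Fin L) :
    derivative^[K] (coeffPoly f l) = 0 := by
  rcases Nat.eq_zero_or_pos K with hK | hK
  · subst hK
    simp [coeffPoly]
  · apply iterate_derivative_eq_zero
    have h : (coeffPoly f l).natDegree ≤ K - 1 := by
      apply natDegree_sum_le_of_forall_le
      intro k _
      exact (natDegree_C_mul_X_pow_le _ _).trans (by have := k.isLt; omega)
    omega

/-- The frequencies `σ_l`, each repeated `K` times, as a sequence indexed by `ℕ` (value `0` beyond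
`KL`). [folklore] -/
def freq (σ : Fin L → ℂ) (K : ℕ) (i : ℕ) : ℂ :=
  if h : i < K * L then σ (finProdFinEquiv.symm ⟨i, h⟩).2 else 0

/-- `|η_i| ≤ S` when `|σ_l| ≤ S` and `S ≥ 0`. [folklore] -/
theorem norm_freq_le {σ : Fin L → ℂ} {S : ℝ} (hσ : ∀ l, ‖σ l‖ ≤ S) (hS : 0 ≤ S) (K i : ℕ) :
    ‖freq σ K i‖ ≤ S := by
  unfold freq
  split_ifs
  · exact hσ _
  · simpa using hS

/-- On the image of `(k, l)` the repeated-frequency sequence takes the value `σ_l`. [folklore] -/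
theorem freq_apply (σ : Fin L → ℂ) (K : ℕ) (p : Fin K × Fin L) :
    freq σ K (finProdFinEquiv p : ℕ) = σ p.2 := by
  unfold freq
  rw [dif_pos (finProdFinEquiv p).isLt, Fin.eta, Equiv.symm_apply_apply]

/-- Products over the repeated frequencies: `∏_{i<KL} g(η_i) = ∏_l g(σ_l)^K`. [folklore] -/
theorem prod_range_freq {M : Type*} [CommMonoid M] (σ : Fin L → ℂ) (K : ℕ) (g : ℂ → M) :
    ∏ i ∈ range (K * L), g (freq σ K i) = ∏ l, g (σ l) ^ K := by
  rw [Finset.prod_range,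
    ← Fintype.prod_equiv finProdFinEquiv (fun p : Fin K × Fin L => g (σ p.2))
      (fun i : Fin (K * L) => g (freq σ K i)) (fun p => by rw [freq_apply]),
    Fintype.prod_prod_type, Finset.prod_comm]
  simp [Finset.prod_const]

/-- `X^K ∣ ∏_{i<KL} (X + (σ_l - η_i))`: the `K` factors with `η_i = σ_l` are `X`. [folklore] -/
theorem X_pow_dvd_prod_freq (σ : Fin L → ℂ) (K : ℕ) (l : Fin L) :
    X ^ K ∣ ∏ i ∈ range (K * L), (X + C (σ l - freq σ K i)) := by
  rw [prod_range_freq σ K (fun a => X + C (σ l - a))]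
  have h : (fun l' : Fin L => (X + C (σ l - σ l')) ^ K) l = X ^ K := by simp
  rw [← h]
  exact Finset.dvd_prod_of_mem _ (Finset.mem_univ l)

/-- `F_N = 0` for `N = KL`: the `KL`-th iterate of the coefficient polynomials vanishes.
[folklore] -/
theorem pseq_coeffPoly_eq_zero (f : Fin K → Fin L → ℂ) (σ : Fin L → ℂ) :
    pseq σ (freq σ K) (coeffPoly f) (K * L) = 0 := by
  funext l
  exact pseq_eq_zero_of_dvd σ _ _ l (X_pow_dvd_prod_freq σ K l) (iterate_derivative_coeffPoly f l)

/-- `qexp 0 σ = 0`. [folklore] -/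
@[simp] theorem qexp_zero (σ : Fin L → ℂ) : qexp (0 : Fin L → ℂ[X]) σ = 0 := by
  funext z
  simp [qexp]

/-! ### Integrating `Y' - aY = G` along a segment -/

/-- If `Y' = G + aY` with `|a| ≤ S` and `|G(w)| ≤ e^{S|w-z₀|} ∑_{n<m} b_n |w-z₀|^n`, then
`|Y(z)| ≤ e^{S|z-z₀|} (|Y(z₀)| + ∑_{n<m} b_n |z-z₀|^{n+1}/(n+1))` (variation of constants along
`[z₀, z]`). [folklore] -/
theorem norm_le_of_hasDerivAt {Y G : ℂ → ℂ} {a : ℂ} (hY : ∀ w, HasDerivAt Y (G w + a * Y w) w)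
    (hG : Continuous G) {S : ℝ} (ha : ‖a‖ ≤ S) (z₀ z : ℂ) {m : ℕ} {b : ℕ → ℝ}
    (hGb : ∀ w, ‖G w‖ ≤ Real.exp (S * ‖w - z₀‖) * ∑ n ∈ range m, b n * ‖w - z₀‖ ^ n) :
    ‖Y z‖ ≤ Real.exp (S * ‖z - z₀‖) *
      (‖Y z₀‖ + ∑ n ∈ range m, b n * ‖z - z₀‖ ^ (n + 1) / (n + 1)) := by
  have hS : 0 ≤ S := (norm_nonneg a).trans ha
  set v : ℂ := z - z₀ with hv
  set r : ℝ := ‖v‖ with hr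
  set g : ℂ → ℂ := fun u => cexp (-a * u * v) * Y (z₀ + u * v) with hgdef
  have hg : ∀ u : ℂ, HasDerivAt g (v * cexp (-a * u * v) * G (z₀ + u * v)) u := by
    intro u
    have h1 : HasDerivAt (fun u : ℂ => cexp (-a * u * v)) (cexp (-a * u * v) * (-a * v)) u := by
      have h0 : HasDerivAt (fun u : ℂ => -a * u * v) (-a * 1 * v) u :=
        ((hasDerivAt_id u).const_mul (-a)).mul_const v
      rw [mul_one] at h0
      exact h0.cexp
    have h2 : HasDerivAt (fun u : ℂ => Y (z₀ + u * v))
        ((G (z₀ + u * v) + a * Y (z₀ + u * v)) * v) u := by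
      have hin : HasDerivAt (fun u : ℂ => z₀ + u * v) (1 * v) u :=
        ((hasDerivAt_id u).mul_const v).const_add z₀
      rw [one_mul] at hin
      exact (hY (z₀ + u * v)).comp u hin
    exact (h1.mul h2).congr_deriv (by ring)
  have hg' : ∀ t : ℝ, HasDerivAt (fun t : ℝ => g t)
      (v * cexp (-a * t * v) * G (z₀ + t * v)) t := fun t => (hg t).comp_ofReal
  have hGc : Continuous fun t : ℝ => v * cexp (-a * t * v) * G (z₀ + t * v) := by
    have : Continuous fun t : ℝ => z₀ + (t : ℂ) * v := by fun_prop
    exact ((continuous_const.mul (by fun_prop)).mul (hG.comp this))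
  have hint := intervalIntegral.integral_eq_sub_of_hasDerivAt (a := (0 : ℝ)) (b := 1)
    (fun t _ => hg' t) (hGc.intervalIntegrable _ _)
  have hg0 : g ((0 : ℝ) : ℂ) = Y z₀ := by simp [hgdef]
  have hg1 : g ((1 : ℝ) : ℂ) = cexp (-a * v) * Y z := by simp [hgdef, hv]
  -- `Y z = e^{av} Y z₀ + ∫₀¹ e^{av} v e^{-atv} G(z₀ + tv) dt`
  have hYz : Y z = cexp (a * v) * Y z₀ +
      ∫ t in (0 : ℝ)..1, cexp (a * v) * (v * cexp (-a * t * v) * G (z₀ + t * v)) := by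
    rw [intervalIntegral.integral_const_mul, hint, hg0, hg1]
    have h1 : cexp (a * v) * cexp (-a * v) = 1 := by
      rw [← Complex.exp_add]
      simp
    linear_combination (-Y z) * h1
  -- pointwise bound for the integrand on `(0, 1]`
  have hbound : ∀ t ∈ Set.Ioc (0 : ℝ) 1,
      ‖cexp (a * v) * (v * cexp (-a * t * v) * G (z₀ + t * v))‖ ≤
        Real.exp (S * r) * r * ∑ n ∈ range m, b n * r ^ n * t ^ n := by
    intro t ht
    have ht0 : 0 ≤ t := ht.1.le
    have ht1 : t ≤ 1 := ht.2
    have hexp : ‖cexp (a * v) * cexp (-a * t * v)‖ ≤ Real.exp (S * (1 - t) * r) := by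
      rw [← Complex.exp_add]
      refine (Complex.norm_exp_le_exp_norm _).trans (Real.exp_le_exp.mpr ?_)
      have : a * v + -a * ↑t * v = a * v * (1 - t) := by ring
      rw [this, norm_mul, norm_mul]
      have h1t : ‖(1 - (t : ℂ))‖ = 1 - t := by
        rw [show (1 : ℂ) - (t : ℂ) = ((1 - t : ℝ) : ℂ) by push_cast; ring, Complex.norm_real,
          Real.norm_eq_abs, abs_of_nonneg (by linarith)]
      rw [h1t, hr]
      have := mul_le_mul_of_nonneg_right ha (norm_nonneg v)
      nlinarith [norm_nonneg v, mul_nonneg (mul_nonneg hS (norm_nonneg v)) (by linarith : (0:ℝ) ≤ 1 - t)]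
    have hGt : ‖G (z₀ + t * v)‖ ≤ Real.exp (S * (t * r)) * ∑ n ∈ range m, b n * r ^ n * t ^ n := by
      have h := hGb (z₀ + t * v)
      have hn : ‖z₀ + ↑t * v - z₀‖ = t * r := by
        rw [add_sub_cancel_left, norm_mul, Complex.norm_real, Real.norm_eq_abs, abs_of_nonneg ht0, hr]
      rw [hn] at h
      refine h.trans (le_of_eq ?_)
      congr 1
      refine Finset.sum_congr rfl fun n _ => ?_
      rw [mul_pow]; ring
    calc ‖cexp (a * v) * (v * cexp (-a * ↑t * v) * G (z₀ + ↑t * v))‖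
        = ‖cexp (a * v) * cexp (-a * ↑t * v)‖ * ‖v‖ * ‖G (z₀ + ↑t * v)‖ := by
          simp only [norm_mul]; ring
      _ ≤ Real.exp (S * (1 - t) * r) * r * (Real.exp (S * (t * r)) *
            ∑ n ∈ range m, b n * r ^ n * t ^ n) := by
          rw [← hr]
          gcongr
      _ = Real.exp (S * r) * r * ∑ n ∈ range m, b n * r ^ n * t ^ n := by
          have : Real.exp (S * (1 - t) * r) * Real.exp (S * (t * r)) = Real.exp (S * r) := by
            rw [← Real.exp_add]; ring_nf
          calc _ = Real.exp (S * (1 - t) * r) * Real.exp (S * (t * r)) * r *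
                ∑ n ∈ range m, b n * r ^ n * t ^ n := by ring
            _ = _ := by rw [this]
  -- integrate the bound
  have hφi : IntervalIntegrable (fun t : ℝ => Real.exp (S * r) * r * ∑ n ∈ range m, b n * r ^ n * t ^ n)
      MeasureTheory.volume 0 1 := by
    apply Continuous.intervalIntegrable
    fun_prop
  have hφ : ∫ t in (0 : ℝ)..1, Real.exp (S * r) * r * ∑ n ∈ range m, b n * r ^ n * t ^ n =
      Real.exp (S * r) * ∑ n ∈ range m, b n * r ^ (n + 1) / (n + 1) := by
    rw [intervalIntegral.integral_const_mul, intervalIntegral.integral_finsetSum]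
    · rw [mul_assoc, Finset.mul_sum]
      congr 1
      refine Finset.sum_congr rfl fun n _ => ?_
      rw [intervalIntegral.integral_const_mul, integral_pow]
      simp
      ring
    · intro n _
      exact (Continuous.intervalIntegrable (by fun_prop) _ _)
  have hI : ‖∫ t in (0 : ℝ)..1, cexp (a * v) * (v * cexp (-a * t * v) * G (z₀ + t * v))‖ ≤
      Real.exp (S * r) * ∑ n ∈ range m, b n * r ^ (n + 1) / (n + 1) := by
    rw [← hφ]
    exact intervalIntegral.norm_integral_le_of_norm_le zero_le_one
      (Filter.Eventually.of_forall hbound) hφi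
  have hfirst : ‖cexp (a * v) * Y z₀‖ ≤ Real.exp (S * r) * ‖Y z₀‖ := by
    rw [norm_mul]
    gcongr
    refine (Complex.norm_exp_le_exp_norm _).trans (Real.exp_le_exp.mpr ?_)
    rw [norm_mul, hr]
    exact mul_le_mul_of_nonneg_right ha (norm_nonneg v)
  calc ‖Y z‖ = ‖cexp (a * v) * Y z₀ +
        ∫ t in (0 : ℝ)..1, cexp (a * v) * (v * cexp (-a * t * v) * G (z₀ + t * v))‖ := by
          rw [← hYz]
    _ ≤ ‖cexp (a * v) * Y z₀‖ +
        ‖∫ t in (0 : ℝ)..1, cexp (a * v) * (v * cexp (-a * t * v) * G (z₀ + t * v))‖ :=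
          norm_add_le _ _
    _ ≤ Real.exp (S * r) * ‖Y z₀‖ + Real.exp (S * r) * ∑ n ∈ range m, b n * r ^ (n + 1) / (n + 1) :=
          add_le_add hfirst hI
    _ = _ := by rw [hr, hv]; ring


/-! ### The growth lemma -/

/-- Downward induction along `F_j' - η_j F_j = F_{j+1}`, `F_N = 0`:
`|F_j(w)| ≤ e^{S|w-z₀|} ∑_{n<N-j} |F_{j+n}(z₀)| |w-z₀|^n / n!`. [folklore] -/
theorem norm_fseq_le (Q : Fin L → ℂ[X]) (σ : Fin L → ℂ) (η : ℕ → ℂ) {S : ℝ} (hη : ∀ i, ‖η i‖ ≤ S)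
    {N : ℕ} (hN : pseq σ η Q N = 0) (z₀ : ℂ) (d j : ℕ) (hjd : j + d = N) (w : ℂ) :
    ‖qexp (pseq σ η Q j) σ w‖ ≤ Real.exp (S * ‖w - z₀‖) *
      ∑ n ∈ range d, ‖qexp (pseq σ η Q (j + n)) σ z₀‖ * ‖w - z₀‖ ^ n / n ! := by
  induction d generalizing j w with
  | zero =>
    simp only [add_zero] at hjd
    subst hjd
    simp [hN]
  | succ d ih =>
    have hj1 : (j + 1) + d = N := by omega
    have hY : ∀ w, HasDerivAt (qexp (pseq σ η Q j) σ)
        (qexp (pseq σ η Q (j + 1)) σ w + η j * qexp (pseq σ η Q j) σ w) w :=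
      fun w => hasDerivAt_qexp _ σ (η j) w
    have hb := norm_le_of_hasDerivAt hY (differentiable_qexp _ σ).continuous (hη j) z₀ w
      (m := d) (b := fun n => ‖qexp (pseq σ η Q (j + 1 + n)) σ z₀‖ / n !) (fun w' => by
        refine (ih (j + 1) hj1 w').trans (le_of_eq ?_)
        congr 1
        refine Finset.sum_congr rfl fun n _ => ?_
        ring)
    refine hb.trans (le_of_eq ?_)
    congr 1
    rw [Finset.sum_range_succ', add_comm]
    simp only [add_zero, pow_zero, Nat.factorial_zero, Nat.cast_one, div_one, mul_one]
    congr 1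
    refine Finset.sum_congr rfl fun n _ => ?_
    rw [show j + (n + 1) = j + 1 + n by omega, Nat.factorial_succ]
    push_cast
    have : (n ! : ℝ) ≠ 0 := by positivity
    field_simp

/-- Cauchy's inequality, one step: if `|Y| ≤ B` on the disc of radius `ρ` about `z₀` and
`|a| ≤ S`, then `|Y' - aY| ≤ (1/δ + S) B` on the disc of radius `ρ - δ`. [folklore] -/
theorem norm_deriv_sub_le {Y : ℂ → ℂ} (hY : Differentiable ℂ Y) {a : ℂ} {S B ρ δ : ℝ}
    (ha : ‖a‖ ≤ S) (hδ : 0 < δ) (z₀ : ℂ) (hB : ∀ w, ‖w - z₀‖ ≤ ρ → ‖Y w‖ ≤ B) {w : ℂ}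
    (hw : ‖w - z₀‖ ≤ ρ - δ) : ‖deriv Y w - a * Y w‖ ≤ (1 / δ + S) * B := by
  have hBw : ‖Y w‖ ≤ B := hB w (by linarith)
  have hB0 : 0 ≤ B := (norm_nonneg _).trans hBw
  have h1 : ‖deriv Y w‖ ≤ B / δ := by
    refine Complex.norm_deriv_le_of_forall_mem_sphere_norm_le hδ hY.diffContOnCl fun ζ hζ => hB ζ ?_
    rw [mem_sphere_iff_norm] at hζ
    calc ‖ζ - z₀‖ ≤ ‖ζ - w‖ + ‖w - z₀‖ := norm_sub_le_norm_sub_add_norm_sub _ _ _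
      _ ≤ δ + (ρ - δ) := by rw [hζ]; linarith
      _ = ρ := by ring
  calc ‖deriv Y w - a * Y w‖ ≤ ‖deriv Y w‖ + ‖a * Y w‖ := norm_sub_le _ _
    _ ≤ B / δ + S * B := by
        rw [norm_mul]
        exact add_le_add h1 (mul_le_mul ha hBw (norm_nonneg _) ((norm_nonneg _).trans ha))
    _ = (1 / δ + S) * B := by ring

/-- Upward induction: `|F_i| ≤ (1/δ + S)^i M` on the disc of radius `R - iδ`. [folklore] -/
theorem norm_fseq_ball_le (Q : Fin L → ℂ[X]) (σ : Fin L → ℂ) (η : ℕ → ℂ) {S : ℝ}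
    (hη : ∀ i, ‖η i‖ ≤ S) (z₀ : ℂ) {R M δ : ℝ} (hδ : 0 < δ)
    (hM : ∀ w, ‖w - z₀‖ ≤ R → ‖qexp Q σ w‖ ≤ M) (i : ℕ) (w : ℂ) (hw : ‖w - z₀‖ ≤ R - i * δ) :
    ‖qexp (pseq σ η Q i) σ w‖ ≤ (1 / δ + S) ^ i * M := by
  induction i generalizing w with
  | zero => simpa using hM w (by simpa using hw)
  | succ i ih =>
    have h := norm_deriv_sub_le (differentiable_qexp (pseq σ η Q i) σ) (hη i) hδ z₀
      (ρ := R - i * δ) (B := (1 / δ + S) ^ i * M) (fun w' hw' => ih w' hw') (w := w)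
      (by push_cast at hw; linarith)
    rw [deriv_qexp_sub] at h
    have heq : (1 / δ + S) * ((1 / δ + S) ^ i * M) = (1 / δ + S) ^ (i + 1) * M := by ring
    rw [heq] at h
    exact h

/-- **Growth lemma** for `∑ Q_l e^{σ_l z}`: if `|η_i| ≤ S`, `F_N = 0` and `|F| ≤ M` on the disc
of radius `R > 0` about `z₀`, then `|F(w)| ≤ M exp((2S + 2N/R)|w - z₀|)` everywhere. [folklore] -/
theorem qexp_growth (Q : Fin L → ℂ[X]) (σ : Fin L → ℂ) (η : ℕ → ℂ) {S : ℝ} (hη : ∀ i, ‖η i‖ ≤ S)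
    {N : ℕ} (hN : pseq σ η Q N = 0) (z₀ : ℂ) {R M : ℝ} (hR : 0 < R)
    (hM : ∀ w, ‖w - z₀‖ ≤ R → ‖qexp Q σ w‖ ≤ M) (w : ℂ) :
    ‖qexp Q σ w‖ ≤ M * Real.exp ((2 * S + 2 * N / R) * ‖w - z₀‖) := by
  have hS : 0 ≤ S := (norm_nonneg _).trans (hη 0)
  have hM0 : 0 ≤ M := (norm_nonneg _).trans (hM z₀ (by simp [hR.le]))
  set r := ‖w - z₀‖ with hr
  have hr0 : 0 ≤ r := norm_nonneg _
  rcases Nat.eq_zero_or_pos N with hN0 | hNpos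
  · subst hN0
    have hQ : Q = 0 := by simpa using hN
    subst hQ
    simp only [qexp_zero, Pi.zero_apply, norm_zero]
    positivity
  · set δ : ℝ := R / (2 * N) with hδ
    have hNr : (0 : ℝ) < N := by exact_mod_cast hNpos
    have hδ0 : 0 < δ := by positivity
    have hA : 1 / δ + S = 2 * N / R + S := by
      rw [hδ]
      field_simp
    have h1 := norm_fseq_le Q σ η hη hN z₀ N 0 (by simp) w
    simp only [zero_add, pseq_zero] at h1
    have hc : ∀ n ∈ range N, ‖qexp (pseq σ η Q n) σ z₀‖ * r ^ n / n ! ≤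
        M * (((2 * N / R + S) * r) ^ n / n !) := by
      intro n hn
      have hn' : n < N := mem_range.mp hn
      have hcn : ‖qexp (pseq σ η Q n) σ z₀‖ ≤ (1 / δ + S) ^ n * M :=
        norm_fseq_ball_le Q σ η hη z₀ hδ0 hM n z₀ (by
          simp only [sub_self, norm_zero, hδ]
          have hle : (n : ℝ) ≤ N := by exact_mod_cast hn'.le
          rw [sub_nonneg, mul_div_assoc']
          rw [div_le_iff₀ (by positivity)]
          nlinarith)
      rw [hA] at hcn
      have h2 : ‖qexp (pseq σ η Q n) σ z₀‖ * r ^ n ≤ M * ((2 * N / R + S) * r) ^ n := by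
        rw [mul_pow, ← mul_assoc, mul_comm M]
        exact mul_le_mul_of_nonneg_right hcn (pow_nonneg hr0 n)
      rw [mul_div_assoc']
      exact div_le_div_of_nonneg_right h2 (by positivity)
    calc ‖qexp Q σ w‖
        ≤ Real.exp (S * r) * ∑ n ∈ range N, ‖qexp (pseq σ η Q n) σ z₀‖ * r ^ n / n ! := h1
      _ ≤ Real.exp (S * r) * ∑ n ∈ range N, M * (((2 * N / R + S) * r) ^ n / n !) := by
          gcongr with n hn
          exact hc n hn
      _ = Real.exp (S * r) * (M * ∑ n ∈ range N, ((2 * N / R + S) * r) ^ n / n !) := by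
          congr 1
          rw [Finset.mul_sum]
      _ ≤ Real.exp (S * r) * (M * Real.exp ((2 * N / R + S) * r)) := by
          gcongr
          exact Real.sum_le_exp_of_nonneg (by positivity) N
      _ = M * Real.exp ((2 * S + 2 * N / R) * r) := by
          rw [← mul_assoc, mul_comm (Real.exp _) M, mul_assoc, ← Real.exp_add]
          congr 1
          ring

/-- **Growth lemma for Baker's exponential polynomials**: if `|σ_l| ≤ S` (`S ≥ 0`) and
`|F| ≤ M` on the closed disc of radius `R > 0` about `z₀`, then
`|F(w)| ≤ M exp((2S + 2KL/R) |w - z₀|)` for every `w`. (Baker 1975, p. 114, proves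
`M(4R) ≤ M(R) e^{8RS} 4^{KL}`; any bound of this shape suffices for Lemma 1.)
[cite: BakerTNT1975, Ch. 12 §2, pp. 113–114] -/
theorem expPolynomial_growth (f : Fin K → Fin L → ℂ) (σ : Fin L → ℂ) {S R M : ℝ}
    (hσ : ∀ l, ‖σ l‖ ≤ S) (hS : 0 ≤ S) (hR : 0 < R) (z₀ : ℂ)
    (hM : ∀ w, ‖w - z₀‖ ≤ R → ‖expPolynomial f σ w‖ ≤ M) (w : ℂ) :
    ‖expPolynomial f σ w‖ ≤ M * Real.exp ((2 * S + 2 * ((K * L : ℕ) : ℝ) / R) * ‖w - z₀‖) := by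
  rw [expPolynomial_eq_qexp] at hM ⊢
  exact qexp_growth (coeffPoly f) σ (freq σ K) (norm_freq_le hσ hS K) (pseq_coeffPoly_eq_zero f σ)
    z₀ hR hM w

/-! ### Counting zeros (Baker's Jensen-type argument) -/

/-- Global division by the zeros of a multiset, with multiplicities: if
`count_b Z ≤ ord_b F` for all `b`, then `F = (∏_{a ∈ Z} (z - a)) · G` with `G` entire. [folklore] -/
theorem exists_eq_multiset_prod_mul {F : ℂ → ℂ} (hF : Differentiable ℂ F) (Z : Multiset ℂ)
    (hZ : ∀ b, (Multiset.count b Z : ℕ∞) ≤ analyticOrderAt F b) :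
    ∃ G : ℂ → ℂ, Differentiable ℂ G ∧ ∀ z, F z = (Z.map fun a => z - a).prod * G z := by
  induction Z using Multiset.induction_on generalizing F with
  | empty => exact ⟨F, hF, fun z => by simp⟩
  | cons a Z ih =>
    have ha : ((1 : ℕ) : ℕ∞) ≤ analyticOrderAt F a := by
      refine le_trans ?_ (hZ a)
      simp
    obtain ⟨G₁, hG₁, hFG₁⟩ := Baker1975.Analytic.exists_eq_pow_mul hF a 1 ha
    have hZ' : ∀ b, (Multiset.count b Z : ℕ∞) ≤ analyticOrderAt G₁ b := by
      intro b
      have hFeq : F = (fun z => (z - a) ^ 1) * G₁ := funext fun z => by simp [hFG₁ z]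
      have h := hZ b
      rw [hFeq, analyticOrderAt_mul (by fun_prop) (hG₁.analyticAt b), Multiset.count_cons] at h
      by_cases hba : b = a
      · subst hba
        have h1 : analyticOrderAt (fun z => (z - b) ^ 1) b = (1 : ℕ) := by
          rw [AnalyticAt.analyticOrderAt_eq_natCast (by fun_prop)]
          exact ⟨fun _ => 1, analyticAt_const, one_ne_zero, by simp⟩
        rw [h1, if_pos rfl] at h
        have h' : (1 : ℕ∞) + (Multiset.count b Z : ℕ∞) ≤ 1 + analyticOrderAt G₁ b := by
          simpa [add_comm] using h
        exact (ENat.add_le_add_iff_left ENat.one_ne_top).mp h'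
      · have h0 : analyticOrderAt (fun z => (z - a) ^ 1) b = 0 := by
          rw [analyticOrderAt_eq_zero]
          exact Or.inr (by simp [sub_ne_zero.mpr hba])
        rw [h0, zero_add, if_neg hba] at h
        simpa using h
    obtain ⟨G, hG, hG₁G⟩ := ih hG₁ hZ'
    refine ⟨G, hG, fun z => ?_⟩
    rw [hFG₁ z, hG₁G z, Multiset.map_cons, Multiset.prod_cons]
    ring

/-- `|∏_{a ∈ Z} (u - a)| ≤ B^{#Z}` if `|u - a| ≤ B` on `Z`. [folklore] -/
theorem norm_multiset_prod_sub_le (Z : Multiset ℂ) (u : ℂ) {B : ℝ} (h : ∀ a ∈ Z, ‖u - a‖ ≤ B) :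
    ‖(Z.map fun a => u - a).prod‖ ≤ B ^ Multiset.card Z := by
  induction Z using Multiset.induction_on with
  | empty => simp
  | cons a Z ih =>
    rw [Multiset.map_cons, Multiset.prod_cons, norm_mul, Multiset.card_cons, pow_succ, mul_comm]
    have hB : 0 ≤ B := (norm_nonneg _).trans (h a (Multiset.mem_cons_self a Z))
    exact mul_le_mul (ih fun b hb => h b (Multiset.mem_cons_of_mem hb)) (h a (Multiset.mem_cons_self a Z))
      (norm_nonneg _) (pow_nonneg hB _)

/-- `B^{#Z} ≤ |∏_{a ∈ Z} (v - a)|` if `0 ≤ B ≤ |v - a|` on `Z`. [folklore] -/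
theorem pow_le_norm_multiset_prod_sub (Z : Multiset ℂ) (v : ℂ) {B : ℝ} (hB : 0 ≤ B)
    (h : ∀ a ∈ Z, B ≤ ‖v - a‖) : B ^ Multiset.card Z ≤ ‖(Z.map fun a => v - a).prod‖ := by
  induction Z using Multiset.induction_on with
  | empty => simp
  | cons a Z ih =>
    rw [Multiset.map_cons, Multiset.prod_cons, norm_mul, Multiset.card_cons, pow_succ, mul_comm]
    exact mul_le_mul (h a (Multiset.mem_cons_self a Z)) (ih fun b hb => h b (Multiset.mem_cons_of_mem hb))
      (pow_nonneg hB _) (norm_nonneg _)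

/-- **Baker's counting argument** (p. 113): if the entire `F` vanishes on the multiset `Z` (with
multiplicities) inside the disc of radius `R` about `z₀`, `F(u) ≠ 0` at a point `u` of that disc,
and `|F(w)| ≤ |F(u)| e^{A|w - z₀|}` everywhere (`A ≥ 0`), then `#Z · log 2 ≤ 5AR` (maximum
modulus for `F/W`, `W = ∏ (z - a)`, between the circles of radii `R` and `5R`).
[cite: BakerTNT1975, Ch. 12 §2, p. 113] -/
theorem card_mul_log_two_le {F : ℂ → ℂ} (hF : Differentiable ℂ F) (Z : Multiset ℂ)
    (hZ : ∀ b, (Multiset.count b Z : ℕ∞) ≤ analyticOrderAt F b) (z₀ u : ℂ) {R A : ℝ} (hR : 0 < R)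
    (hZR : ∀ a ∈ Z, ‖a - z₀‖ ≤ R) (hu : ‖u - z₀‖ ≤ R) (hFu : F u ≠ 0)
    (hgrowth : ∀ w, ‖F w‖ ≤ ‖F u‖ * Real.exp (A * ‖w - z₀‖)) :
    Multiset.card Z * Real.log 2 ≤ 5 * A * R := by
  obtain ⟨G, hG, hFG⟩ := exists_eq_multiset_prod_mul hF Z hZ
  set h := Multiset.card Z with hh
  have hFu0 : 0 < ‖F u‖ := norm_pos_iff.mpr hFu
  -- `|W(u)| ≤ (2R)^h`
  have hWu : ‖(Z.map fun a => u - a).prod‖ ≤ (2 * R) ^ h := by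
    refine norm_multiset_prod_sub_le Z u fun a ha => ?_
    calc ‖u - a‖ ≤ ‖u - z₀‖ + ‖z₀ - a‖ := norm_sub_le_norm_sub_add_norm_sub _ _ _
      _ ≤ R + R := add_le_add hu (by rw [norm_sub_rev]; exact hZR a ha)
      _ = 2 * R := by ring
  -- maximum modulus for `G` on the disc of radius `5R`
  set C : ℝ := ‖F u‖ * Real.exp (A * (5 * R)) / (4 * R) ^ h with hC
  have hC0 : 0 ≤ C := by positivity
  have hGbd : ∀ v ∈ frontier (ball z₀ (5 * R)), ‖G v‖ ≤ C := by
    rw [frontier_ball z₀ (by positivity : (5 * R) ≠ 0)]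
    intro v hv
    rw [mem_sphere_iff_norm] at hv
    have hWv : (4 * R) ^ h ≤ ‖(Z.map fun a => v - a).prod‖ := by
      refine pow_le_norm_multiset_prod_sub Z v (by positivity) fun a ha => ?_
      have := norm_sub_norm_le (v - z₀) (a - z₀)
      rw [sub_sub_sub_cancel_right] at this
      linarith [hZR a ha]
    have hWpos : 0 < ‖(Z.map fun a => v - a).prod‖ := lt_of_lt_of_le (by positivity) hWv
    have hFv : ‖F v‖ ≤ ‖F u‖ * Real.exp (A * (5 * R)) := by
      have := hgrowth v
      rwa [hv] at this
    have hGv : ‖G v‖ = ‖F v‖ / ‖(Z.map fun a => v - a).prod‖ := by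
      rw [hFG v, norm_mul, mul_div_cancel_left₀ _ hWpos.ne']
    rw [hGv, hC]
    exact div_le_div₀ (by positivity) hFv (by positivity) hWv
  have hGu : ‖G u‖ ≤ C := by
    refine Complex.norm_le_of_forall_mem_frontier_norm_le isBounded_ball hG.diffContOnCl hGbd ?_
    rw [closure_ball z₀ (by positivity : (5 * R) ≠ 0), mem_closedBall_iff_norm]
    linarith
  -- `|F(u)| ≤ (2R)^h C = |F(u)| e^{5AR} / 2^h`
  have hkey : ‖F u‖ * 2 ^ h ≤ ‖F u‖ * Real.exp (A * (5 * R)) := by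
    have h1 : ‖F u‖ ≤ (2 * R) ^ h * C := by
      rw [hFG u, norm_mul]
      exact mul_le_mul hWu hGu (norm_nonneg _) (by positivity)
    have h2 : (2 * R) ^ h * C * 2 ^ h = ‖F u‖ * Real.exp (A * (5 * R)) := by
      rw [hC]
      have h4 : (4 * R) ^ h = (2 * R) ^ h * 2 ^ h := by rw [← mul_pow]; ring
      rw [h4]
      field_simp
    calc ‖F u‖ * 2 ^ h ≤ (2 * R) ^ h * C * 2 ^ h := by gcongr
      _ = _ := h2
  have h2h : (2 : ℝ) ^ h ≤ Real.exp (A * (5 * R)) := le_of_mul_le_mul_left hkey hFu0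
  have hlog := Real.log_le_log (by positivity) h2h
  rw [Real.log_pow, Real.log_exp] at hlog
  linarith

end Tijdeman

open Tijdeman in
/-- **Tijdeman's lemma in Baker's form, with the explicit constant `30`**: for
`F(z) = ∑ f(k,l) z^k e^{σ_l z}`, `|σ_l| ≤ S`, `F ≢ 0`, every multiset of zeros of `F` (with
multiplicities) inside a closed disc of radius `R ≥ 0` has at most `30 (KL + RS)` elements.
[cite: BakerTNT1975, Ch. 12 §2 Lemma 1, pp. 112–114] -/
theorem card_zeroMultiset_expPolynomial_le {K L : ℕ} (f : Fin K → Fin L → ℂ) (σ : Fin L → ℂ)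
    {S R : ℝ} (z₀ : ℂ) (hσ : ∀ l, ‖σ l‖ ≤ S) (hR0 : 0 ≤ R) (hF : expPolynomial f σ ≠ 0)
    (Z : Multiset ℂ) (hZR : ∀ z ∈ Z, ‖z - z₀‖ ≤ R) (hZ : IsZeroMultiset (expPolynomial f σ) Z) :
    (Multiset.card Z : ℝ) ≤ 30 * (K * L + R * S) := by
  -- `K, L ≥ 1`, `S ≥ 0`
  rcases Nat.eq_zero_or_pos K with hK | hK
  · subst hK; exact absurd (expPolynomial_eq_zero_of_K_eq_zero f σ) hF
  rcases Nat.eq_zero_or_pos L with hL | hL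
  · subst hL; exact absurd (expPolynomial_eq_zero_of_L_eq_zero f σ) hF
  have hS : 0 ≤ S := (norm_nonneg _).trans (hσ ⟨0, hL⟩)
  have hKL : (1 : ℝ) ≤ ((K * L : ℕ) : ℝ) := by exact_mod_cast Nat.mul_le_mul hK hL
  set F := expPolynomial f σ with hFdef
  have hFdiff : Differentiable ℂ F := by
    rw [hFdef, expPolynomial_eq_qexp]; exact differentiable_qexp _ _
  -- orders of vanishing from the derivatives
  have hord : ∀ b, (Multiset.count b Z : ℕ∞) ≤ analyticOrderAt F b := by
    intro b
    by_cases hb : b ∈ Z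
    · exact Baker1975.Analytic.le_analyticOrderAt_of_iteratedDeriv_eq_zero hFdiff (hZ b hb)
    · simp [Multiset.count_eq_zero_of_notMem hb]
  -- a slightly larger positive radius
  set R₁ : ℝ := R + 1 / (S + 1) with hR₁
  have hS1 : 0 < S + 1 := by linarith
  have hR₁0 : 0 < R₁ := by positivity
  have hRR₁ : R ≤ R₁ := by rw [hR₁]; have := one_div_pos.mpr hS1; linarith
  -- the maximum of `|F|` on the closed disc of radius `R₁`
  obtain ⟨u, hu, humax⟩ := (isCompact_closedBall z₀ R₁).exists_isMaxOn
    (nonempty_closedBall.mpr hR₁0.le) hFdiff.continuous.norm.continuousOn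
  rw [mem_closedBall_iff_norm] at hu
  have hM : ∀ w, ‖w - z₀‖ ≤ R₁ → ‖F w‖ ≤ ‖F u‖ := fun w hw =>
    humax (mem_closedBall_iff_norm.mpr hw)
  have hFu : F u ≠ 0 := by
    intro h0
    apply hF
    have hev : F =ᶠ[𝓝 z₀] 0 := by
      filter_upwards [Metric.ball_mem_nhds z₀ hR₁0] with w hw
      rw [mem_ball_iff_norm] at hw
      have := hM w hw.le
      rw [h0, norm_zero] at this
      exact norm_le_zero_iff.mp this
    exact AnalyticOnNhd.eq_of_eventuallyEq (analyticOnNhd_univ_iff_differentiable.mpr hFdiff)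
      analyticOnNhd_const hev
  -- growth and counting
  have hgrowth := expPolynomial_growth f σ hσ hS hR₁0 z₀ hM
  have hcount := card_mul_log_two_le hFdiff Z hord z₀ u hR₁0 (fun a ha => (hZR a ha).trans hRR₁)
    hu hFu hgrowth
  have h5 : 5 * (2 * S + 2 * ((K * L : ℕ) : ℝ) / R₁) * R₁ = 10 * (S * R₁) + 10 * ((K * L : ℕ) : ℝ) := by
    field_simp
    ring
  rw [h5] at hcount
  have hSR₁ : S * R₁ ≤ S * R + 1 := by
    rw [hR₁, mul_add]
    have : S * (1 / (S + 1)) ≤ 1 := by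
      rw [mul_one_div, div_le_one hS1]; linarith
    linarith
  have hlog : (0.6931471803 : ℝ) < Real.log 2 := Real.log_two_gt_d9
  have hcard0 : (0 : ℝ) ≤ Multiset.card Z := by positivity
  have hRS : 0 ≤ R * S := mul_nonneg hR0 hS
  have h1 : (Multiset.card Z : ℝ) * 0.6931471803 ≤ 20 * ((K * L : ℕ) : ℝ) + 10 * (R * S) := by
    have := mul_le_mul_of_nonneg_left hlog.le hcard0
    nlinarith
  push_cast at h1 hKL ⊢
  nlinarith

open Tijdeman in
/-- **Tijdeman's lemma in Baker's form, proved** (`c = 30`). Discharges the named fact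
`Baker1975_tijdemanLemma` of `TijdemanZeroEstimate.lean`.
[cite: BakerTNT1975, Ch. 12 §2 Lemma 1, pp. 112–114] -/
theorem Baker1975_tijdemanLemma_holds : Baker1975_tijdemanLemma :=
  ⟨30, by norm_num, fun _ _ f σ _ _ z₀ hσ hR hF Z hZR hZ =>
    card_zeroMultiset_expPolynomial_le f σ z₀ hσ hR hF Z hZR hZ⟩

end Literature.NumberTheory.Transcendental

end
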